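import Mathlib

/-!
# SoloBlind kernel #218 — the scalar energy inequality behind the Gramian scheme (LEMMA R, non-autonomy)

In the Gramian scheme (lemmaR-A5 §18) the observability-Gramian energy `E(B) = x(B)* P_{s(B)} x(B) ≥ 0`
of the true (non-autonomous) column satisfies `E' ≤ -|g·x|² + L·E`, where `L` is the relative
`s`-modulus of the frozen Gramians.  The scalar consequence certified here:
`∫₀ᵀ f(B) e^{-LB} dB ≤ E(0)` for every `T ≥ 0` whenever `E ≥ 0`, `E' ≤ -f + L E` on `[0,T]`.
With `f = |g·x|²` and `E(0) = x₀* P_{s₀} x₀ =` the engine's Plancherel integral, this is the statement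
"non-autonomy costs only a shift of the Plancherel line by `L/2`".
-/

namespace Summit.AnomalousDissipation.AnomalousDissipation.Theorems

open MeasureTheory Real intervalIntegral

/-- FTC for the weighted energy `E(x) e^{-Lx}`. -/
theorem weighted_energy_ftc (E E' : ℝ → ℝ) (L T : ℝ) (hE : ∀ x, HasDerivAt E (E' x) x)
    (hint : IntervalIntegrable (fun x => (E' x - L * E x) * exp (-L * x)) volume 0 T) :
    ∫ x in (0:ℝ)..T, (E' x - L * E x) * exp (-L * x) = E T * exp (-L * T) - E 0 * exp (-L * 0) := by
  apply integral_eq_sub_of_hasDerivAt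
  · intro x _
    have h0 : HasDerivAt (fun y => -L * y) (-L) x := by simpa using (hasDerivAt_id x).const_mul (-L)
    exact ((hE x).mul h0.exp).congr_deriv (by ring)
  · exact hint

/-- **Energy inequality.** `E ≥ 0`, `E' ≤ -f + L E` on `[0,T]` ⇒ `∫₀ᵀ f e^{-Lx} dx ≤ E 0`. -/
theorem gramian_energy_ineq (E E' f : ℝ → ℝ) (L T : ℝ) (hT : 0 ≤ T)
    (hE : ∀ x, HasDerivAt E (E' x) x) (hEnn : ∀ x, 0 ≤ E x)
    (hdiss : ∀ x ∈ Set.Icc 0 T, E' x ≤ -f x + L * E x)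
    (hfi : IntervalIntegrable (fun x => f x * exp (-L * x)) volume 0 T)
    (hint : IntervalIntegrable (fun x => (E' x - L * E x) * exp (-L * x)) volume 0 T) :
    ∫ x in (0:ℝ)..T, f x * exp (-L * x) ≤ E 0 := by
  have hmono : ∫ x in (0:ℝ)..T, f x * exp (-L * x) ≤ ∫ x in (0:ℝ)..T, -((E' x - L * E x) * exp (-L * x)) := by
    apply intervalIntegral.integral_mono_on hT hfi hint.neg
    intro x hx
    simp only [Pi.neg_apply]
    have hpos : 0 < exp (-L * x) := exp_pos _
    have := hdiss x hx
    nlinarith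
  rw [intervalIntegral.integral_neg, weighted_energy_ftc E E' L T hE hint] at hmono
  have h0 : exp (-L * 0) = 1 := by simp
  rw [h0, mul_one] at hmono
  have hET : 0 ≤ E T * exp (-L * T) := mul_nonneg (hEnn T) (exp_pos _).le
  linarith

/-- Letting `T → ∞`: the improper integral `∫₀^∞ f e^{-Lx}` is bounded by `E 0` as soon as every truncation is;
stated for the `Set.Ioi` integral of an integrable weighted integrand. -/
theorem gramian_energy_ineq_Ioi (E E' f : ℝ → ℝ) (L : ℝ)
    (hE : ∀ x, HasDerivAt E (E' x) x) (hEnn : ∀ x, 0 ≤ E x)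
    (hdiss : ∀ x, 0 ≤ x → E' x ≤ -f x + L * E x)
    (hfI : IntegrableOn (fun x => f x * exp (-L * x)) (Set.Ioi 0) volume)
    (hint : ∀ T, 0 ≤ T → IntervalIntegrable (fun x => (E' x - L * E x) * exp (-L * x)) volume 0 T) :
    ∫ x in Set.Ioi (0:ℝ), f x * exp (-L * x) ≤ E 0 := by
  -- the truncated integrals converge to the Ioi integral and are each ≤ E 0
  have hlim := intervalIntegral_tendsto_integral_Ioi (a := (0:ℝ)) (f := fun x => f x * exp (-L * x)) hfI Filter.tendsto_id
  refine le_of_tendsto hlim ?_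
  filter_upwards [Filter.eventually_ge_atTop (0:ℝ)] with T hT
  have hfi : IntervalIntegrable (fun x => f x * exp (-L * x)) volume 0 T :=
    (intervalIntegrable_iff_integrableOn_Ioc_of_le hT).mpr (hfI.mono_set Set.Ioc_subset_Ioi_self)
  exact gramian_energy_ineq E E' f L T hT hE hEnn (fun x hx => hdiss x hx.1) hfi (hint T hT)

end Summit.AnomalousDissipation.AnomalousDissipation.Theorems
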